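import Summits.CriticalPhenomena.PercolationContinuityZ3.Theorems.PercNearOneGluingNoHeavyLowerTailCubicFourPointL1Step
import Mathlib.Tactic.Ring
import Mathlib.Tactic.Linarith
import Mathlib.Tactic.Positivity
import HarnessLib

/-!
# `NoHeavyLowerTail` (stmt-CriticalPhenomena-4575) — the polarised E3GRP form (L1) in the 15 cells: boundary strata and the pendant-`y` pencil

Support file (prover prim-l12-p2, `--supports stmt-CriticalPhenomena-4575`; P2 = deletion–contraction induction).  Pure algebra (`ring`),
no sorries, no named facts; one definition `HybMasses.ofCells` = the 14 event masses of `…CubicFourPointL1Step` as cell sums of the 15-cell law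
of the set partitions of `(a,b,c,y)` (cell names `«a|b|c|y»`, …, `«abcy»` as in `CubicThreePointStep.threeB₁_polarization`), so that
`(ofCells …).L1` is literally harness-2's `E3(D_bc,D_ac,G_ab) + E3(D_bc,G_ac,D_ab) − β₃·m(D_bc)` at total mass `1`.

RESULTS (exact identities found by computer algebra in the seat's engine, re-proved here by `ring` on the hyperplane "total mass `= 1`", since
`HybMasses.L1` has `σ = 1` built in; `F` = SHK3⁺ of `…BernsteinStep`):
* STRATA where (L1) is decided by known three-point theorems:
  `L1_cells_y_isolated` (`y` joined to nothing): `L1 = 2·F(a,b,c)`;  `L1_cells_y_eq_a` (`y` glued to `a`): `L1 = 2·F`;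
  `L1_cells_b_isolated`, `L1_cells_c_isolated`: `L1 = 0`;  `L1_cells_a_isolated`: `L1 = q't' − u'_y(u'_b + u'_c)` in the cells of
  `(b,c,y)` `= AG(b,c,y) + u'_b u'_c` (Aas–Gladkov);  `L1_cells_y_eq_b` (`y` glued to `b`): `L1 = F + u₃·(q t − u₁u₃ + t u₂)` (`≥ 0` from
  `F ≥ 0` and AG `qt ≥ u₁u₃`).  So the four-point content of (L1) is: distinct terminals, `y` joined to the rest, off the cut-vertex faces.
* THE PENDANT-`y` PENCIL (`L1_cells_pendant_y`).  If `y` hangs off a cut vertex `u` (`u` separates `y` from `a,b,c`; `r = P(y ~ u inside the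
  pendant block)`), the law of `(a,b,c,y)` is `(1−r)·ι(λ) + r·λ` with `λ` = law of `(a,b,c,u)` and `ι` = "`y` isolated", and ALONG THIS PENCIL
  (L1) IS AFFINE:  `L1 = 2(1−r)·F(a,b,c) + r·L1(λ)`  (the Bernstein pieces are `4F + L1(λ)` and `2F + 2L1(λ)`: `y` enters each slot of each
  hybrid row at most once).  Hence (`L1_cells_pendant_y_nonneg`) hanging `y` behind a cut vertex PRESERVES (L1) given only SHK3⁺ `F ≥ 0`
  (a theorem, prim-lit-2 g9): w.l.o.g. `y` is not separated from `{a,b,c}` by a cut vertex.  (The pendant-`a`/`b`/`c` pencils are quadratic,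
  not affine, and their middle coefficients are NEW four-point cubics — seat memo MEMO-P2-DC.md.)
[cite: Gladkov2024StrongFKG, Cor. 4.2 (the cubic rows; AG)]; [cite: GladkovZimin2024HK, §4 (one-coordinate / block decomposition)]
-/

namespace Summit.CriticalPhenomena.PercolationContinuityZ3.Theorems

namespace HybMasses

open CubicThreePointStep

variable {R : Type*} [CommRing R]

/-- The 14 event masses of (L1) as cell sums of the 15-cell law of `(a,b,c,y)` (`D_uv` = blocks of `u,v` differ; `G_ab` = `b` apart from
`a` and `y`; `β` = the cell `a|bcy`).  The two cells `«abc|y»`, `«abcy»` (where `a,b,c` are one block) enter none of the 14 masses, so they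
are not arguments; at total mass `1` they are recovered as `1 −` the other thirteen. [folklore] -/
def ofCells («a|b|c|y» «a|b|cy» «a|by|c» «a|bc|y» «ay|b|c» «ac|b|y» «ab|c|y» «a|bcy» «ay|bc» «ac|by» «acy|b» «ab|cy» «aby|c» : R) :
    HybMasses R where
  bc := «a|b|c|y» + «a|b|cy» + «a|by|c» + «ay|b|c» + «ac|b|y» + «ab|c|y» + «ac|by» + «acy|b» + «ab|cy» + «aby|c»
  ac := «a|b|c|y» + «a|b|cy» + «a|by|c» + «a|bc|y» + «ay|b|c» + «ab|c|y» + «a|bcy» + «ay|bc» + «ab|cy» + «aby|c»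
  ab := «a|b|c|y» + «a|b|cy» + «a|by|c» + «a|bc|y» + «ay|b|c» + «ac|b|y» + «a|bcy» + «ay|bc» + «ac|by» + «acy|b»
  gb := «a|b|c|y» + «a|b|cy» + «a|bc|y» + «ay|b|c» + «ac|b|y» + «ay|bc» + «acy|b»
  gc := «a|b|c|y» + «a|by|c» + «a|bc|y» + «ay|b|c» + «ab|c|y» + «ay|bc» + «aby|c»
  β := «a|bcy»
  bc_ac := «a|b|c|y» + «a|b|cy» + «a|by|c» + «ay|b|c» + «ab|c|y» + «ab|cy» + «aby|c»
  bc_gb := «a|b|c|y» + «a|b|cy» + «ay|b|c» + «ac|b|y» + «acy|b»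
  ac_gb := «a|b|c|y» + «a|b|cy» + «a|bc|y» + «ay|b|c» + «ay|bc»
  bc_ac_gb := «a|b|c|y» + «a|b|cy» + «ay|b|c»
  bc_gc := «a|b|c|y» + «a|by|c» + «ay|b|c» + «ab|c|y» + «aby|c»
  bc_ab := «a|b|c|y» + «a|b|cy» + «a|by|c» + «ay|b|c» + «ac|b|y» + «ac|by» + «acy|b»
  gc_ab := «a|b|c|y» + «a|by|c» + «a|bc|y» + «ay|b|c» + «ay|bc»
  bc_gc_ab := «a|b|c|y» + «a|by|c» + «ay|b|c»

/-! ### Strata -/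

/-- **`y` isolated**: only the cells with `y` a singleton (`q = «a|b|c|y»`, `u₁ = «ab|c|y»`, `u₂ = «ac|b|y»`, `u₃ = «a|bc|y»`, `t = «abc|y»`)
carry mass; then `L1 = 2·F(a,b,c)`. [folklore] -/
theorem L1_cells_y_isolated (q u₁ u₂ u₃ t : R) (hσ : q + u₁ + u₂ + u₃ + t = 1) :
    (ofCells q 0 0 u₃ 0 u₂ u₁ 0 0 0 0 0 0).L1 = 2 * F q u₁ u₂ u₃ t := by
  have ht : t = 1 - q - u₁ - u₂ - u₃ := by rw [← hσ]; ring
  subst ht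
  simp only [ofCells, L1, E3h, F]; ring

/-- **`y` glued to `a`** (cells `«ay|b|c» = q`, `«aby|c» = u₁`, `«acy|b» = u₂`, `«ay|bc» = u₃`, `«abcy» = t`): `L1 = 2·F(a,b,c)`. [folklore] -/
theorem L1_cells_y_eq_a (q u₁ u₂ u₃ t : R) (hσ : q + u₁ + u₂ + u₃ + t = 1) :
    (ofCells 0 0 0 0 q 0 0 0 u₃ 0 u₂ 0 u₁).L1 = 2 * F q u₁ u₂ u₃ t := by
  have ht : t = 1 - q - u₁ - u₂ - u₃ := by rw [← hσ]; ring
  subst ht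
  simp only [ofCells, L1, E3h, F]; ring

/-- **`b` isolated** (cells `«a|b|c|y», «a|b|cy», «ay|b|c», «ac|b|y», «acy|b»`): `L1 = 0`. [folklore] -/
theorem L1_cells_b_isolated (x₁ x₂ x₅ x₆ x₁₁ : R) (hσ : x₁ + x₂ + x₅ + x₆ + x₁₁ = 1) :
    (ofCells x₁ x₂ 0 0 x₅ x₆ 0 0 0 0 x₁₁ 0 0).L1 = 0 := by
  have h : x₁₁ = 1 - x₁ - x₂ - x₅ - x₆ := by rw [← hσ]; ring
  subst h
  simp only [ofCells, L1, E3h]; ring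

/-- **`c` isolated** (cells `«a|b|c|y», «a|by|c», «ay|b|c», «ab|c|y», «aby|c»`): `L1 = 0`. [folklore] -/
theorem L1_cells_c_isolated (x₁ x₃ x₅ x₇ x₁₃ : R) (hσ : x₁ + x₃ + x₅ + x₇ + x₁₃ = 1) :
    (ofCells x₁ 0 x₃ 0 x₅ 0 x₇ 0 0 0 0 0 x₁₃).L1 = 0 := by
  have h : x₁₃ = 1 - x₁ - x₃ - x₅ - x₇ := by rw [← hσ]; ring
  subst h
  simp only [ofCells, L1, E3h]; ring

/-- **`a` isolated**: in the cells of `(b,c,y)` (`q' = «a|b|c|y»`, `u'_b = «a|b|cy»` (`b` apart, `c~y`), `u'_c = «a|by|c»`, `u'_y = «a|bc|y»`,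
`t' = «a|bcy»`, total mass `1`), `L1 = q't' − u'_y(u'_b + u'_c) = AG(b,c,y) + u'_b u'_c` — nonnegative by Aas–Gladkov. [folklore] -/
theorem L1_cells_a_isolated (q' ub uc uy t' : R) (hσ : q' + ub + uc + uy + t' = 1) :
    (ofCells q' ub uc uy 0 0 0 t' 0 0 0 0 0).L1 = q' * t' - uy * (ub + uc) := by
  have h : t' = 1 - q' - ub - uc - uy := by rw [← hσ]; ring
  subst h
  simp only [ofCells, L1, E3h]; ring

/-- **`y` glued to `b`** (cells `«a|by|c» = q`, `«aby|c» = u₁`, `«ac|by» = u₂`, `«a|bcy» = u₃`, `«abcy» = t` of `(a,b,c)`):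
`L1 = F + u₃·(q t − u₁u₃ + t u₂)` (nonnegative from SHK3⁺ and AG `qt ≥ u₁u₃`). [folklore] -/
theorem L1_cells_y_eq_b (q u₁ u₂ u₃ t : R) (hσ : q + u₁ + u₂ + u₃ + t = 1) :
    (ofCells 0 0 q 0 0 0 0 u₃ 0 u₂ 0 0 u₁).L1 = F q u₁ u₂ u₃ t + u₃ * (q * t - u₁ * u₃ + t * u₂) := by
  have ht : t = 1 - q - u₁ - u₂ - u₃ := by rw [← hσ]; ring
  subst ht
  simp only [ofCells, L1, E3h, F]; ring

/-- … hence `L1 ≥ 0` there, from `F ≥ 0`, `qt ≥ u₁u₃` and nonnegative cells. [folklore] -/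
theorem L1_cells_y_eq_b_nonneg {q u₁ u₂ u₃ t : ℝ} (hσ : q + u₁ + u₂ + u₃ + t = 1) (hF : 0 ≤ F q u₁ u₂ u₃ t)
    (hAG : u₁ * u₃ ≤ q * t) (hu₂ : 0 ≤ u₂) (hu₃ : 0 ≤ u₃) (ht : 0 ≤ t) : 0 ≤ (ofCells 0 0 q 0 0 0 0 u₃ 0 u₂ 0 0 u₁).L1 := by
  rw [L1_cells_y_eq_b q u₁ u₂ u₃ t hσ]
  have h1 : 0 ≤ q * t - u₁ * u₃ + t * u₂ := by nlinarith [mul_nonneg ht hu₂]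
  nlinarith [mul_nonneg hu₃ h1]

/-! ### The pendant-`y` pencil: (L1) is affine, with endpoints `2F` and `L1(λ)` -/

/-- **Pendant-`y` pencil.**  `λ` = the 15 cells of `(a,b,c,u)` (written with `y` standing for `u`); the law of `(a,b,c,y)` when `y` hangs
off `u` with connection probability `r` is `(1−r)·ι(λ) + r·λ` (`ι`: `y` becomes a singleton).  Along this pencil
`L1 = 2(1−r)·F(a,b,c) + r·L1(λ)` — AFFINE in `r`. [folklore] -/
theorem L1_cells_pendant_y («a|b|c|y» «a|b|cy» «a|by|c» «a|bc|y» «ay|b|c» «ac|b|y» «ab|c|y» «a|bcy» «ay|bc» «ac|by» «acy|b» «ab|cy» «aby|c» «abc|y» «abcy» r : R)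
    (hσ : «a|b|c|y» + «a|b|cy» + «a|by|c» + «a|bc|y» + «ay|b|c» + «ac|b|y» + «ab|c|y» + «a|bcy» + «ay|bc» + «ac|by» + «acy|b» + «ab|cy» + «aby|c» + «abc|y» + «abcy» = 1) :
    (ofCells ((1 - r) * («a|b|c|y» + «a|b|cy» + «a|by|c» + «ay|b|c») + r * «a|b|c|y») (r * «a|b|cy») (r * «a|by|c»)
        ((1 - r) * («a|bc|y» + «a|bcy» + «ay|bc») + r * «a|bc|y») (r * «ay|b|c»)
        ((1 - r) * («ac|b|y» + «ac|by» + «acy|b») + r * «ac|b|y») ((1 - r) * («ab|c|y» + «ab|cy» + «aby|c») + r * «ab|c|y»)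
        (r * «a|bcy») (r * «ay|bc») (r * «ac|by») (r * «acy|b») (r * «ab|cy») (r * «aby|c»)).L1
      = 2 * (1 - r) * F («a|b|c|y» + «a|b|cy» + «a|by|c» + «ay|b|c») («ab|c|y» + «ab|cy» + «aby|c») («ac|b|y» + «ac|by» + «acy|b»)
            («a|bc|y» + «a|bcy» + «ay|bc») («abc|y» + «abcy»)
        + r * (ofCells «a|b|c|y» «a|b|cy» «a|by|c» «a|bc|y» «ay|b|c» «ac|b|y» «ab|c|y» «a|bcy» «ay|bc» «ac|by» «acy|b» «ab|cy» «aby|c»).L1 := by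
  have h : «abcy» = 1 - («a|b|c|y» + «a|b|cy» + «a|by|c» + «a|bc|y» + «ay|b|c» + «ac|b|y» + «ab|c|y» + «a|bcy» + «ay|bc» + «ac|by» + «acy|b» + «ab|cy» + «aby|c» + «abc|y») := by
    rw [← hσ]; ring
  subst h
  simp only [ofCells, L1, E3h, F]; ring

/-- **Hanging `y` behind a cut vertex preserves (L1)**, given only SHK3⁺ `F(a,b,c) ≥ 0` and (L1) for the base law `λ` (and `r ∈ [0,1]`).
[folklore] -/
theorem L1_cells_pendant_y_nonneg {«a|b|c|y» «a|b|cy» «a|by|c» «a|bc|y» «ay|b|c» «ac|b|y» «ab|c|y» «a|bcy» «ay|bc» «ac|by» «acy|b» «ab|cy» «aby|c» «abc|y» «abcy» r : ℝ}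
    (hσ : «a|b|c|y» + «a|b|cy» + «a|by|c» + «a|bc|y» + «ay|b|c» + «ac|b|y» + «ab|c|y» + «a|bcy» + «ay|bc» + «ac|by» + «acy|b» + «ab|cy» + «aby|c» + «abc|y» + «abcy» = 1)
    (hr0 : 0 ≤ r) (hr1 : r ≤ 1)
    (hF : 0 ≤ F («a|b|c|y» + «a|b|cy» + «a|by|c» + «ay|b|c») («ab|c|y» + «ab|cy» + «aby|c») («ac|b|y» + «ac|by» + «acy|b»)
            («a|bc|y» + «a|bcy» + «ay|bc») («abc|y» + «abcy»))
    (hL : 0 ≤ (ofCells «a|b|c|y» «a|b|cy» «a|by|c» «a|bc|y» «ay|b|c» «ac|b|y» «ab|c|y» «a|bcy» «ay|bc» «ac|by» «acy|b» «ab|cy» «aby|c»).L1) :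
    0 ≤ (ofCells ((1 - r) * («a|b|c|y» + «a|b|cy» + «a|by|c» + «ay|b|c») + r * «a|b|c|y») (r * «a|b|cy») (r * «a|by|c»)
        ((1 - r) * («a|bc|y» + «a|bcy» + «ay|bc») + r * «a|bc|y») (r * «ay|b|c»)
        ((1 - r) * («ac|b|y» + «ac|by» + «acy|b») + r * «ac|b|y») ((1 - r) * («ab|c|y» + «ab|cy» + «aby|c») + r * «ab|c|y»)
        (r * «a|bcy») (r * «ay|bc») (r * «ac|by») (r * «acy|b») (r * «ab|cy») (r * «aby|c»)).L1 := by
  rw [L1_cells_pendant_y _ _ _ _ _ _ _ _ _ _ _ _ _ _ _ r hσ]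
  have h1 : 0 ≤ 1 - r := by linarith
  have e1 : 0 ≤ 2 * (1 - r) * F («a|b|c|y» + «a|b|cy» + «a|by|c» + «ay|b|c») («ab|c|y» + «ab|cy» + «aby|c») («ac|b|y» + «ac|by» + «acy|b»)
      («a|bc|y» + «a|bcy» + «ay|bc») («abc|y» + «abcy») := mul_nonneg (mul_nonneg (by norm_num) h1) hF
  have e2 := mul_nonneg hr0 hL
  linarith

/-! ### The pendant-`b` pencil: quadratic, with the new four-point row `PB` as its first-order coefficient

(Appended by prim-l12-p2, same session.)  If the terminal `b` hangs off a vertex `u` with connection probability `r`, the law of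
`(a,b,c,y)` is `(1−r)·ι_b(λ) + r·λ` with `λ` = law of `(a,u,c,y)` (`u` in the role of `b`) and `ι_b` = "`b` a singleton".  On the
isolated end `L1 = 0` (`L1_cells_b_isolated`) and the CUBIC COEFFICIENT VANISHES:  `L1 = r(1−r)·PB(λ) + r²·L1(λ)`  (`L1_cells_pendant_b`),
where `PB` (`PBc` below, at total mass `1`) is the new four-point cubic
  `PB = H(D_bc,D_ac) + H(D_ac,G_ab) + H(D_bc,G_ac) + H(G_ac,D_ab) + β·P(a~c) − T·(P(a≁c) + P(c≁{a,y}))`,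
`H(X,Y) = P(X∩Y) − P(X)P(Y)` (Harris forms of decreasing events = covariances of the complementary connection events), `T = P(a~b~c)`.
So `PB ≥ 0` on realizable laws is NECESSARY for (L1) (let `r → 0`) and, with (L1) for `λ`, sufficient for (L1) on pendant-`b` graphs
(`L1_cells_pendant_b_nonneg`); in the `y`-isolated stratum `PB = 2(qt − u₂(u₁+u₃)) ≥ 2·AG` (`PBc_y_isolated`).  Census: seat, exact,
0/8 000; ttrl request l.528.  (The pendant-`a` pencil is likewise quadratic; its coefficient is another new four-point cubic — memo §3b.)
-/

/-- **The four-point row `PB`** (pendant-`b` shadow of (L1)), at total mass `1`, on the thirteen cells (`T = P(a~b~c) = 1 − Σ` of them):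
`PB = H(D_bc,D_ac) + H(D_ac,G_ab) + H(D_bc,G_ac) + H(G_ac,D_ab) + β·P(a~c) − T·(P(a≁c) + P(c≁{a,y}))`. [folklore] -/
def PBc («a|b|c|y» «a|b|cy» «a|by|c» «a|bc|y» «ay|b|c» «ac|b|y» «ab|c|y» «a|bcy» «ay|bc» «ac|by» «acy|b» «ab|cy» «aby|c» : R) : R :=
  ((ofCells «a|b|c|y» «a|b|cy» «a|by|c» «a|bc|y» «ay|b|c» «ac|b|y» «ab|c|y» «a|bcy» «ay|bc» «ac|by» «acy|b» «ab|cy» «aby|c»).bc_ac - (ofCells «a|b|c|y» «a|b|cy» «a|by|c» «a|bc|y» «ay|b|c» «ac|b|y» «ab|c|y» «a|bcy» «ay|bc» «ac|by» «acy|b» «ab|cy» «aby|c»).bc * (ofCells «a|b|c|y» «a|b|cy» «a|by|c» «a|bc|y» «ay|b|c» «ac|b|y» «ab|c|y» «a|bcy» «ay|bc» «ac|by» «acy|b» «ab|cy» «aby|c»).ac)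
    + ((ofCells «a|b|c|y» «a|b|cy» «a|by|c» «a|bc|y» «ay|b|c» «ac|b|y» «ab|c|y» «a|bcy» «ay|bc» «ac|by» «acy|b» «ab|cy» «aby|c»).ac_gb - (ofCells «a|b|c|y» «a|b|cy» «a|by|c» «a|bc|y» «ay|b|c» «ac|b|y» «ab|c|y» «a|bcy» «ay|bc» «ac|by» «acy|b» «ab|cy» «aby|c»).ac * (ofCells «a|b|c|y» «a|b|cy» «a|by|c» «a|bc|y» «ay|b|c» «ac|b|y» «ab|c|y» «a|bcy» «ay|bc» «ac|by» «acy|b» «ab|cy» «aby|c»).gb)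
    + ((ofCells «a|b|c|y» «a|b|cy» «a|by|c» «a|bc|y» «ay|b|c» «ac|b|y» «ab|c|y» «a|bcy» «ay|bc» «ac|by» «acy|b» «ab|cy» «aby|c»).bc_gc - (ofCells «a|b|c|y» «a|b|cy» «a|by|c» «a|bc|y» «ay|b|c» «ac|b|y» «ab|c|y» «a|bcy» «ay|bc» «ac|by» «acy|b» «ab|cy» «aby|c»).bc * (ofCells «a|b|c|y» «a|b|cy» «a|by|c» «a|bc|y» «ay|b|c» «ac|b|y» «ab|c|y» «a|bcy» «ay|bc» «ac|by» «acy|b» «ab|cy» «aby|c»).gc)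
    + ((ofCells «a|b|c|y» «a|b|cy» «a|by|c» «a|bc|y» «ay|b|c» «ac|b|y» «ab|c|y» «a|bcy» «ay|bc» «ac|by» «acy|b» «ab|cy» «aby|c»).gc_ab - (ofCells «a|b|c|y» «a|b|cy» «a|by|c» «a|bc|y» «ay|b|c» «ac|b|y» «ab|c|y» «a|bcy» «ay|bc» «ac|by» «acy|b» «ab|cy» «aby|c»).gc * (ofCells «a|b|c|y» «a|b|cy» «a|by|c» «a|bc|y» «ay|b|c» «ac|b|y» «ab|c|y» «a|bcy» «ay|bc» «ac|by» «acy|b» «ab|cy» «aby|c»).ab)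
    + (ofCells «a|b|c|y» «a|b|cy» «a|by|c» «a|bc|y» «ay|b|c» «ac|b|y» «ab|c|y» «a|bcy» «ay|bc» «ac|by» «acy|b» «ab|cy» «aby|c»).β * (1 - (ofCells «a|b|c|y» «a|b|cy» «a|by|c» «a|bc|y» «ay|b|c» «ac|b|y» «ab|c|y» «a|bcy» «ay|bc» «ac|by» «acy|b» «ab|cy» «aby|c»).ac)
    - (1 - («a|b|c|y» + «a|b|cy» + «a|by|c» + «a|bc|y» + «ay|b|c» + «ac|b|y» + «ab|c|y» + «a|bcy» + «ay|bc» + «ac|by» + «acy|b» + «ab|cy» + «aby|c»)) * ((ofCells «a|b|c|y» «a|b|cy» «a|by|c» «a|bc|y» «ay|b|c» «ac|b|y» «ab|c|y» «a|bcy» «ay|bc» «ac|by» «acy|b» «ab|cy» «aby|c»).ac + (ofCells «a|b|c|y» «a|b|cy» «a|by|c» «a|bc|y» «ay|b|c» «ac|b|y» «ab|c|y» «a|bcy» «ay|bc» «ac|by» «acy|b» «ab|cy» «aby|c»).gc)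

/-- **Pendant-`b` pencil** (total mass `1`): `L1((1−r)·ι_b(λ) + r·λ) = r(1−r)·PB(λ) + r²·L1(λ)` — quadratic in `r`, vanishing at the
isolated end. [folklore] -/
theorem L1_cells_pendant_b («a|b|c|y» «a|b|cy» «a|by|c» «a|bc|y» «ay|b|c» «ac|b|y» «ab|c|y» «a|bcy» «ay|bc» «ac|by» «acy|b» «ab|cy» «aby|c» «abc|y» «abcy» r : R)
    (hσ : «a|b|c|y» + «a|b|cy» + «a|by|c» + «a|bc|y» + «ay|b|c» + «ac|b|y» + «ab|c|y» + «a|bcy» + «ay|bc» + «ac|by» + «acy|b» + «ab|cy» + «aby|c» + «abc|y» + «abcy» = 1) :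
    (ofCells ((1 - r) * («a|b|c|y» + «a|by|c» + «a|bc|y» + «ab|c|y») + r * «a|b|c|y») ((1 - r) * («a|b|cy» + «a|bcy» + «ab|cy») + r * «a|b|cy») (r * «a|by|c») (r * «a|bc|y») ((1 - r) * («ay|b|c» + «ay|bc» + «aby|c») + r * «ay|b|c») ((1 - r) * («ac|b|y» + «ac|by» + «abc|y») + r * «ac|b|y») (r * «ab|c|y») (r * «a|bcy») (r * «ay|bc») (r * «ac|by») ((1 - r) * («acy|b» + «abcy») + r * «acy|b») (r * «ab|cy») (r * «aby|c»)).L1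
      = r * (1 - r) * PBc «a|b|c|y» «a|b|cy» «a|by|c» «a|bc|y» «ay|b|c» «ac|b|y» «ab|c|y» «a|bcy» «ay|bc» «ac|by» «acy|b» «ab|cy» «aby|c» + r ^ 2 * (ofCells «a|b|c|y» «a|b|cy» «a|by|c» «a|bc|y» «ay|b|c» «ac|b|y» «ab|c|y» «a|bcy» «ay|bc» «ac|by» «acy|b» «ab|cy» «aby|c»).L1 := by
  have h : «abcy» = 1 - («a|b|c|y» + «a|b|cy» + «a|by|c» + «a|bc|y» + «ay|b|c» + «ac|b|y» + «ab|c|y» + «a|bcy» + «ay|bc» + «ac|by» + «acy|b» + «ab|cy» + «aby|c» + «abc|y») := by rw [← hσ]; ring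
  subst h
  simp only [ofCells, L1, E3h, PBc]; ring

/-- **The pendant-`b` move**: `PB(λ) ≥ 0` and (L1) for `λ` give (L1) along the whole pendant-`b` pencil (`r ∈ [0,1]`). [folklore] -/
theorem L1_cells_pendant_b_nonneg {«a|b|c|y» «a|b|cy» «a|by|c» «a|bc|y» «ay|b|c» «ac|b|y» «ab|c|y» «a|bcy» «ay|bc» «ac|by» «acy|b» «ab|cy» «aby|c» «abc|y» «abcy» r : ℝ}
    (hσ : «a|b|c|y» + «a|b|cy» + «a|by|c» + «a|bc|y» + «ay|b|c» + «ac|b|y» + «ab|c|y» + «a|bcy» + «ay|bc» + «ac|by» + «acy|b» + «ab|cy» + «aby|c» + «abc|y» + «abcy» = 1) (hr0 : 0 ≤ r) (hr1 : r ≤ 1)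
    (hPB : 0 ≤ PBc «a|b|c|y» «a|b|cy» «a|by|c» «a|bc|y» «ay|b|c» «ac|b|y» «ab|c|y» «a|bcy» «ay|bc» «ac|by» «acy|b» «ab|cy» «aby|c») (hL : 0 ≤ (ofCells «a|b|c|y» «a|b|cy» «a|by|c» «a|bc|y» «ay|b|c» «ac|b|y» «ab|c|y» «a|bcy» «ay|bc» «ac|by» «acy|b» «ab|cy» «aby|c»).L1) :
    0 ≤ (ofCells ((1 - r) * («a|b|c|y» + «a|by|c» + «a|bc|y» + «ab|c|y») + r * «a|b|c|y») ((1 - r) * («a|b|cy» + «a|bcy» + «ab|cy») + r * «a|b|cy») (r * «a|by|c») (r * «a|bc|y») ((1 - r) * («ay|b|c» + «ay|bc» + «aby|c») + r * «ay|b|c») ((1 - r) * («ac|b|y» + «ac|by» + «abc|y») + r * «ac|b|y») (r * «ab|c|y») (r * «a|bcy») (r * «ay|bc») (r * «ac|by») ((1 - r) * («acy|b» + «abcy») + r * «acy|b») (r * «ab|cy») (r * «aby|c»)).L1 := by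
  rw [L1_cells_pendant_b «a|b|c|y» «a|b|cy» «a|by|c» «a|bc|y» «ay|b|c» «ac|b|y» «ab|c|y» «a|bcy» «ay|bc» «ac|by» «acy|b» «ab|cy» «aby|c» «abc|y» «abcy» r hσ]
  have h1 : 0 ≤ 1 - r := by linarith
  have e1 : 0 ≤ r * (1 - r) * PBc «a|b|c|y» «a|b|cy» «a|by|c» «a|bc|y» «ay|b|c» «ac|b|y» «ab|c|y» «a|bcy» «ay|bc» «ac|by» «acy|b» «ab|cy» «aby|c» := mul_nonneg (mul_nonneg hr0 h1) hPB
  have e2 : 0 ≤ r ^ 2 * (ofCells «a|b|c|y» «a|b|cy» «a|by|c» «a|bc|y» «ay|b|c» «ac|b|y» «ab|c|y» «a|bcy» «ay|bc» «ac|by» «acy|b» «ab|cy» «aby|c»).L1 := mul_nonneg (pow_nonneg hr0 2) hL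
  linarith

/-- `PB` in the `y`-isolated stratum (cells `q, u₁ = «ab|c|y», u₂ = «ac|b|y», u₃ = «a|bc|y», t = «abc|y»` of `(a,b,c)`, total mass `1`):
`PB = 2(qt − u₂(u₁+u₃)) = 2(AG + u₁u₃)` — an Aas–Gladkov-type form. [folklore] -/
theorem PBc_y_isolated (q u₁ u₂ u₃ t : R) (hσ : q + u₁ + u₂ + u₃ + t = 1) :
    PBc q 0 0 u₃ 0 u₂ u₁ 0 0 0 0 0 0 = 2 * (q * t - u₂ * (u₁ + u₃)) := by
  have ht : t = 1 - q - u₁ - u₂ - u₃ := by rw [← hσ]; ring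
  subst ht
  simp only [ofCells, PBc]; ring

/-- `PB` rewritten through the identities `H(D_ac,G_ab) = γ·P(a~c) + H(D_ac, D[b|acy])`, `H(D_ab,G_ac) = γ·P(a~b) + H(D_ab, D[c|aby])`
(`γ = P(b~c, b≁a, b≁y)`): `PB = H(D_ac,D[b|acy]) + H(D_ab,D[c|aby]) + β·P(c≁{a,y}) + γ·(P(a~b) − P(c~{a,y}))`; here the two remaining Harris
forms and `γ` are written in the cells. [folklore] -/
theorem PBc_eq_cov_form («a|b|c|y» «a|b|cy» «a|by|c» «a|bc|y» «ay|b|c» «ac|b|y» «ab|c|y» «a|bcy» «ay|bc» «ac|by» «acy|b» «ab|cy» «aby|c» «abc|y» «abcy» : R) (hσ : «a|b|c|y» + «a|b|cy» + «a|by|c» + «a|bc|y» + «ay|b|c» + «ac|b|y» + «ab|c|y» + «a|bcy» + «ay|bc» + «ac|by» + «acy|b» + «ab|cy» + «aby|c» + «abc|y» + «abcy» = 1) :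
    PBc «a|b|c|y» «a|b|cy» «a|by|c» «a|bc|y» «ay|b|c» «ac|b|y» «ab|c|y» «a|bcy» «ay|bc» «ac|by» «acy|b» «ab|cy» «aby|c»
      = (((ofCells «a|b|c|y» «a|b|cy» «a|by|c» «a|bc|y» «ay|b|c» «ac|b|y» «ab|c|y» «a|bcy» «ay|bc» «ac|by» «acy|b» «ab|cy» «aby|c»).bc_ac_gb - (ofCells «a|b|c|y» «a|b|cy» «a|by|c» «a|bc|y» «ay|b|c» «ac|b|y» «ab|c|y» «a|bcy» «ay|bc» «ac|by» «acy|b» «ab|cy» «aby|c»).ac * (ofCells «a|b|c|y» «a|b|cy» «a|by|c» «a|bc|y» «ay|b|c» «ac|b|y» «ab|c|y» «a|bcy» «ay|bc» «ac|by» «acy|b» «ab|cy» «aby|c»).bc_gb)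
        + ((ofCells «a|b|c|y» «a|b|cy» «a|by|c» «a|bc|y» «ay|b|c» «ac|b|y» «ab|c|y» «a|bcy» «ay|bc» «ac|by» «acy|b» «ab|cy» «aby|c»).bc_gc_ab - (ofCells «a|b|c|y» «a|b|cy» «a|by|c» «a|bc|y» «ay|b|c» «ac|b|y» «ab|c|y» «a|bcy» «ay|bc» «ac|by» «acy|b» «ab|cy» «aby|c»).ab * (ofCells «a|b|c|y» «a|b|cy» «a|by|c» «a|bc|y» «ay|b|c» «ac|b|y» «ab|c|y» «a|bcy» «ay|bc» «ac|by» «acy|b» «ab|cy» «aby|c»).bc_gc))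
        + (ofCells «a|b|c|y» «a|b|cy» «a|by|c» «a|bc|y» «ay|b|c» «ac|b|y» «ab|c|y» «a|bcy» «ay|bc» «ac|by» «acy|b» «ab|cy» «aby|c»).β * (ofCells «a|b|c|y» «a|b|cy» «a|by|c» «a|bc|y» «ay|b|c» «ac|b|y» «ab|c|y» «a|bcy» «ay|bc» «ac|by» «acy|b» «ab|cy» «aby|c»).gc
        + ((ofCells «a|b|c|y» «a|b|cy» «a|by|c» «a|bc|y» «ay|b|c» «ac|b|y» «ab|c|y» «a|bcy» «ay|bc» «ac|by» «acy|b» «ab|cy» «aby|c»).gb - (ofCells «a|b|c|y» «a|b|cy» «a|by|c» «a|bc|y» «ay|b|c» «ac|b|y» «ab|c|y» «a|bcy» «ay|bc» «ac|by» «acy|b» «ab|cy» «aby|c»).bc_gb) * ((1 - (ofCells «a|b|c|y» «a|b|cy» «a|by|c» «a|bc|y» «ay|b|c» «ac|b|y» «ab|c|y» «a|bcy» «ay|bc» «ac|by» «acy|b» «ab|cy» «aby|c»).ab) - (1 - (ofCells «a|b|c|y» «a|b|cy» «a|by|c» «a|bc|y» «ay|b|c» «ac|b|y» «ab|c|y»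 «a|bcy» «ay|bc» «ac|by» «acy|b» «ab|cy» «aby|c»).gc)) := by
  have h : «abcy» = 1 - («a|b|c|y» + «a|b|cy» + «a|by|c» + «a|bc|y» + «ay|b|c» + «ac|b|y» + «ab|c|y» + «a|bcy» + «ay|bc» + «ac|by» + «acy|b» + «ab|cy» + «aby|c» + «abc|y») := by rw [← hσ]; ring
  subst h
  simp only [ofCells, PBc]; ring

end HybMasses

end Summit.CriticalPhenomena.PercolationContinuityZ3.Theorems
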